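import Summits.QuantumFields.BalabanUV.Beta.GAN24.WilsonLetterFlatCharges

/-!
# `BalabanUV.Beta.GAN24.EdgePlaquettePotential` — binder row G-an2-4 ∕ (CONV-C), the (S) row of RULING R-gan24p1-g27-1 B (viii), the Ward-type half (W-γ) (road-P2 g39),
# EXIT class: **THE EDGE-PLAQUETTE CURL TOTAL IS A FLAT-HESSIAN PAIRING WITH A BOUNDED `L`-PERIODIC 1-FORM**
# (G-an2-4 formalisation swarm → CRUX TEAM (2), seat `b2b-balaban-gan24-formalise-leaf-06` = the (γ) hand, gen 46, INTENT 1)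

NOT IN PRINT; OUR BOOKKEEPING ([folklore] lattice exterior calculus over an2's `AffineAveraging` (`dz ∕ curv ∕ curvAdj ∕ unitVec`, `curv_dz`, `curvAdj_const`)
and leaf-02 g55's PART 7∕7b `FaceChargeCurlResummation` ∕ `WilsonLetterFlatCharges` (`dz_coordFn`) (`curv_smul_fun_dz`, `dz_blk_eq_ite`, the adjointness `tsum_mul_curvAdj_eq_tsum_curv_mul`, the Wilson resummation
`tsum_sum_mul_faceCharge_wilsonA_eq_neg_tsum_edgeCurl`) BY NAME; 0 `def`, 0 cited fact, 0 `def … : Prop`, 0 sorry).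
HONEST FRAMING (cell contract, verbatim): «discharging `BetaPertH` makes Bałaban's UV stability UNCONDITIONAL — a real constructive-QFT result; it is NOT the
continuum limit and NOT the Clay problem.»  HONEST DEPENDENCY (verbatim): «continuum YM on T⁴ ⇐ BetaPertH ∧ nine spine estimates (0/9 proved); BetaPertH ⇐ (D1) ∧ (D4) ∧
CAP+tail; G-an2-4 gates asym, D1 and NE2/3/4.»

SETTING.  leaf-02's PART 7 reduced (W-γ) in the exit class, channel `(a,b)`, `a ≠ b`, to ONE identity for the defect read-vector `r`: the total curl of `r` over the
`L`-periodic family of `(a,b)`-plaquettes at block EDGES, `Σ'_x 𝟙[x_a % L = L−1]·𝟙[x_b % L = L−1]·(curv r) a b x`, vanishes; its potential there is `ψ_a • dzψ_b`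
(`ψ_c = ⌊·_c ∕ L⌋`), which grows linearly.  OBJECTS (`1 ≤ L`, `a ≠ b`; `t_c x := x_c % L`, so `L·ψ_c = x_c − t_c`; `𝟙^{exit}_c x := [x_c % L = L − 1]`;
`E_ab κ l := [κ = a ∧ l = b] − [κ = b ∧ l = a]`, the constant unit `(a,b)` 2-form): the EDGE POTENTIAL
`m̃_ab l x := L⁻²·t_b(x + e_l)·(dz x_a) l x − L⁻¹·t_a(x)·(dzψ_b) l x = L⁻²·[l = a]·t_b(x) − L⁻¹·[l = b]·𝟙^{exit}_b(x)·t_a(x)` — `|m̃_ab| ≤ 1`, `L`-periodic in every direction.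
* §1 `cast_emod_eq` (`t_c = x_c − L·ψ_c` in `ℝ`), `dz_resid` (with leaf-02's `WilsonLetterFlatCharges.dz_coordFn`) (`dz t_c κ x = [κ = c]·(1 − L·𝟙^{exit}_c x)`), `emod_add_unitVec_of_ne`, and the SECOND lattice Leibniz
  rule **`curv_smulEnd_fun_dz`** (function read at the bond's END: `curv (β z ↦ f(z + e_β)·dzg β z) κ l x = dzf κ (x + e_l)·dzg l x − dzf l (x + e_κ)·dzg κ x`; companion of
  PART 7's `curv_smul_fun_dz`).
* §2 `edgePotential_apply`, `abs_edgePotential_le_one`, `edgePotential_add_zsmul` (periodicity), `curv_residEnd_coord`, `curv_resid_blk`, **`curv_edgePotential`**: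
  `curv m̃_ab κ l x = E_ab κ l·(𝟙^{exit}_a x·𝟙^{exit}_b x − L⁻²)` — the edge-plaquette 2-form MINUS the constant `L⁻²•E_ab`, `wedge_blk_eq` (`dzψ_a ∧ dzψ_b = E_ab·𝟙^{exit}_a𝟙^{exit}_b`), `curvAdj_curv_edgePotential` (the constant part is invisible to
  `curvAdj`: `curvAdj (curv m̃_ab) = curvAdj (E_ab·𝟙^{exit}_a𝟙^{exit}_b)`), `curv_sub_dz_apply` ∕ `curvAdj_curv_sub_dz` (the potential is free up to `dz λ`).
* §3 for `r` with `∀ κ, Summable |r κ ·|`: `tsum_curv_eq_zero` (`Σ'_x (curv r) a b x = 0`), the GENERIC **`edgeCurl_eq_half_tsum_mul_curvAdj_of_curv_eq`** (any 1-form `n` with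
  `curv n = E_ab·(𝟙^{exit}_a𝟙^{exit}_b − c)` gives `Σ'_x 𝟙^{exit}_a x·𝟙^{exit}_b x·(curv r) a b x = ½·Σ'_u Σ_κ r κ u·(curvAdj (curv n)) κ u`), its instance
  **`edgeCurl_eq_half_tsum_mul_curvAdj_curv_edgePotential`** (`n = m̃_ab`, `c = L⁻²`), and with PART 7 §3 **`tsum_sum_mul_faceCharge_wilsonA_eq_neg_half_pairing`**: the Wilson
  letter's exit⊗exit charges resummed against `r` are `−½·Σ'_u Σ_κ r κ u·(curvAdj (curv m̃_ab)) κ u`.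
READING.  `curvAdj ∘ curv` IS the field–field block of an2's rooted bordered Hessian (`BorderedHessianRooted.bhKAt_inl_inl`: the windowed `curvAdj (curv (delta1 l y))`), so
(W-γ)_exit(e; a ≠ b) reads **`r(e) ⊥ (d*d) m̃_ab`** for ONE explicit bounded periodic 1-form, free up to `dz λ` (in particular with a hard-axial representative) — the input
shape of the relative-inverse rule `(E∘𝕄)∘G = E` (`ChartConjugationRelative.RelInv`).  The value of the pairing for road-P2's `v_γ + v_{α⁺}` is NOT asserted here.
Asserts NO value of any read vector or table; NOTHING of (W-γ) ∕ (T-F) ∕ (INV) ∕ (S) claimed; NEVER «G-an2-4 closed» as (CONV-C); NOT D1, NOT `BetaPertH`, NOT continuum, NOT Clay.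
2026-08-22; no existing file touched.
-/

noncomputable section
open Finset
open scoped BigOperators
open Literature.MathematicalPhysics.QuantumFieldTheory.Balaban1983to89
open Literature.MathematicalPhysics.QuantumFieldTheory.Balaban1983to89.Beta
open AffineAveraging (Form0 Form1 Form2 dz curv curvAdj curv_dz curvAdj_const unitVec unitVec_apply)
open Summit.QuantumFields.BalabanUV.Beta.GAN24.SymLinKernelFaceSupport (exitFace_eq_dz_blk dz_blk_of_ne)
open Summit.QuantumFields.BalabanUV.Beta.GAN24.WilsonLetterFlatCharges (dz_coordFn)
open Summit.QuantumFields.BalabanUV.Beta.GAN24.FaceChargeCurlResummation (curv_smul_fun_dz dz_blk_eq_ite abs_dz_blk_le_one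
  tsum_mul_curvAdj_eq_tsum_curv_mul tsum_sub_add_sub tsum_sum_mul_faceCharge_wilsonA_eq_neg_tsum_edgeCurl)

namespace Summit.QuantumFields.BalabanUV.Beta.GAN24.EdgePlaquettePotential
variable {d : ℕ}
/-! ## §1 The residue coordinate `t_c = x_c % L`, its derivative, and the second lattice Leibniz rule -/
/-- [folklore] `t_c = x_c − L·ψ_c` in `ℝ` (`Int.emod_def`). -/
theorem cast_emod_eq (L : ℕ) (c : Fin (d + 1)) (x : Fin (d + 1) → ℤ) :
    (((x c % (L : ℤ) : ℤ)) : ℝ) = (x c : ℝ) - (L : ℝ) * (((x c / (L : ℤ) : ℤ)) : ℝ) := by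
  rw [Int.emod_def]; push_cast; ring

/-- [folklore] The derivative of the residue coordinate: `dz t_c κ x = [κ = c]·(1 − L·𝟙^{exit}_c(x))` (`1 ≤ L`). -/
theorem dz_resid {L : ℕ} (hL : 1 ≤ L) (c κ : Fin (d + 1)) (x : Fin (d + 1) → ℤ) :
    dz (fun z : Fin (d + 1) → ℤ => (((z c % (L : ℤ) : ℤ)) : ℝ)) κ x
      = if κ = c then 1 - (L : ℝ) * (if x c % (L : ℤ) = (L : ℤ) - 1 then (1 : ℝ) else 0) else 0 := by
  have e : (fun z : Fin (d + 1) → ℤ => (((z c % (L : ℤ) : ℤ)) : ℝ))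
      = fun z => ((z c : ℤ) : ℝ) - (L : ℝ) * (((z c / (L : ℤ) : ℤ)) : ℝ) := by
    funext z; exact cast_emod_eq L c z
  have hlin : dz (fun z : Fin (d + 1) → ℤ => ((z c : ℤ) : ℝ) - (L : ℝ) * (((z c / (L : ℤ) : ℤ)) : ℝ)) κ x
      = dz (fun z : Fin (d + 1) → ℤ => ((z c : ℤ) : ℝ)) κ x - (L : ℝ) * dz (fun z : Fin (d + 1) → ℤ => (((z c / (L : ℤ) : ℤ)) : ℝ)) κ x := by
    simp only [AffineAveraging.dz]; ring
  rw [e, hlin, dz_coordFn, dz_blk_eq_ite hL]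
  split_ifs <;> ring

/-- [folklore] Stepping along `κ ≠ c` does not change the residue coordinate `t_c`. -/
theorem emod_add_unitVec_of_ne (L : ℕ) (c : Fin (d + 1)) {κ : Fin (d + 1)} (hκ : κ ≠ c) (x : Fin (d + 1) → ℤ) :
    (x + unitVec κ) c % (L : ℤ) = x c % (L : ℤ) := by
  simp [unitVec_apply, Ne.symm hκ]

/-- [folklore] The exit indicator is blind to steps along `κ ≠ c`. -/
theorem exit_add_unitVec_of_ne (L : ℕ) (c : Fin (d + 1)) {κ : Fin (d + 1)} (hκ : κ ≠ c) (x : Fin (d + 1) → ℤ) :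
    (if (x + unitVec κ) c % (L : ℤ) = (L : ℤ) - 1 then (1 : ℝ) else 0) = if x c % (L : ℤ) = (L : ℤ) - 1 then (1 : ℝ) else 0 := by
  rw [emod_add_unitVec_of_ne L c hκ]

/-- [folklore] **THE SECOND LATTICE LEIBNIZ RULE** (the 0-form read at the bond's END): for 0-forms `f g`,
`curv (β z ↦ f(z + e_β)·dzg β z) κ l x = dzf κ (x + e_l)·dzg l x − dzf l (x + e_κ)·dzg κ x` — the companion of PART 7's `curv_smul_fun_dz` (read at the START), again by `dd = 0`. -/
theorem curv_smulEnd_fun_dz (f g : (Fin (d + 1) → ℤ) → ℝ) (κ l : Fin (d + 1)) (x : Fin (d + 1) → ℤ) :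
    curv (fun β z => f (z + unitVec β) * dz g β z) κ l x = dz f κ (x + unitVec l) * dz g l x - dz f l (x + unitVec κ) * dz g κ x := by
  simp only [AffineAveraging.curv, AffineAveraging.dz]
  have e : x + unitVec κ + unitVec l = x + unitVec l + unitVec κ := by abel
  rw [e]; ring

/-! ## §2 The edge potential and its curl -/
/-- NOT IN PRINT; OUR BOOKKEEPING.  The edge potential in closed form: `m̃_ab l x = L⁻²·[l = a]·t_b(x) − L⁻¹·[l = b]·𝟙^{exit}_b(x)·t_a(x)` (`a ≠ b`, `1 ≤ L`). -/
theorem edgePotential_apply {L : ℕ} (hL : 1 ≤ L) {a b : Fin (d + 1)} (hab : a ≠ b) (l : Fin (d + 1)) (x : Fin (d + 1) → ℤ) :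
    ((L : ℝ) ^ 2)⁻¹ * ((((x + unitVec l) b % (L : ℤ) : ℤ)) : ℝ) * dz (fun z : Fin (d + 1) → ℤ => ((z a : ℤ) : ℝ)) l x
        - (L : ℝ)⁻¹ * (((x a % (L : ℤ) : ℤ)) : ℝ) * dz (fun z : Fin (d + 1) → ℤ => (((z b / (L : ℤ) : ℤ)) : ℝ)) l x
      = (if l = a then ((L : ℝ) ^ 2)⁻¹ * (((x b % (L : ℤ) : ℤ)) : ℝ) else 0)
        - (if l = b then (L : ℝ)⁻¹ * (if x b % (L : ℤ) = (L : ℤ) - 1 then (1 : ℝ) else 0) * (((x a % (L : ℤ) : ℤ)) : ℝ) else 0) := by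
  rw [dz_coordFn, dz_blk_eq_ite hL]
  by_cases hla : l = a
  · subst hla
    rw [if_pos rfl, if_pos rfl, if_neg hab, if_neg hab, emod_add_unitVec_of_ne L b hab]; ring
  · rw [if_neg hla, if_neg hla]
    by_cases hlb : l = b
    · subst hlb; rw [if_pos rfl, if_pos rfl]; ring
    · rw [if_neg hlb, if_neg hlb]; ring

/-- [folklore] `0 ≤ t_c ≤ L − 1` in `ℝ` (`1 ≤ L`). -/
theorem cast_emod_nonneg_le {L : ℕ} (hL : 1 ≤ L) (c : Fin (d + 1)) (x : Fin (d + 1) → ℤ) :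
    0 ≤ ((((x c % (L : ℤ) : ℤ)) : ℝ)) ∧ (((x c % (L : ℤ) : ℤ)) : ℝ) ≤ (L : ℝ) - 1 := by
  have hL0 : (0 : ℤ) < L := by exact_mod_cast hL
  have h1 := Int.emod_nonneg (x c) (ne_of_gt hL0)
  have h2 := Int.emod_lt_of_pos (x c) hL0
  constructor
  · exact_mod_cast h1
  · have : x c % (L : ℤ) ≤ (L : ℤ) - 1 := by omega
    exact_mod_cast this

/-- NOT IN PRINT; OUR BOOKKEEPING.  **THE EDGE POTENTIAL IS BOUNDED BY `1`** (`a ≠ b`, `1 ≤ L`). -/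
theorem abs_edgePotential_le_one {L : ℕ} (hL : 1 ≤ L) {a b : Fin (d + 1)} (hab : a ≠ b) (l : Fin (d + 1)) (x : Fin (d + 1) → ℤ) :
    |((L : ℝ) ^ 2)⁻¹ * ((((x + unitVec l) b % (L : ℤ) : ℤ)) : ℝ) * dz (fun z : Fin (d + 1) → ℤ => ((z a : ℤ) : ℝ)) l x
        - (L : ℝ)⁻¹ * (((x a % (L : ℤ) : ℤ)) : ℝ) * dz (fun z : Fin (d + 1) → ℤ => (((z b / (L : ℤ) : ℤ)) : ℝ)) l x| ≤ 1 := by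
  rw [edgePotential_apply hL hab]
  have hLpos : (0 : ℝ) < L := by exact_mod_cast hL
  have hL1 : (1 : ℝ) ≤ L := by exact_mod_cast hL
  obtain ⟨hb0, hb1⟩ := cast_emod_nonneg_le hL b x
  obtain ⟨ha0, ha1⟩ := cast_emod_nonneg_le hL a x
  have hq1 : ((L : ℝ) ^ 2)⁻¹ * (((x b % (L : ℤ) : ℤ)) : ℝ) ≤ 1 := by
    rw [inv_mul_le_iff₀ (by positivity)]; nlinarith
  have hq1' : 0 ≤ ((L : ℝ) ^ 2)⁻¹ * (((x b % (L : ℤ) : ℤ)) : ℝ) := by positivity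
  have hq2 : (L : ℝ)⁻¹ * (((x a % (L : ℤ) : ℤ)) : ℝ) ≤ 1 := by
    rw [inv_mul_le_iff₀ hLpos]; linarith
  have hq2' : 0 ≤ (L : ℝ)⁻¹ * (((x a % (L : ℤ) : ℤ)) : ℝ) := by positivity
  rw [abs_le]
  constructor
  · split_ifs <;> nlinarith
  · split_ifs <;> nlinarith

/-- NOT IN PRINT; OUR BOOKKEEPING.  **THE EDGE POTENTIAL IS `L`-PERIODIC IN EVERY DIRECTION**: `m̃_ab l (x + L•v) = m̃_ab l x`. -/
theorem edgePotential_add_zsmul {L : ℕ} (hL : 1 ≤ L) {a b : Fin (d + 1)} (hab : a ≠ b) (l : Fin (d + 1)) (x v : Fin (d + 1) → ℤ) :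
    ((L : ℝ) ^ 2)⁻¹ * ((((x + (L : ℤ) • v + unitVec l) b % (L : ℤ) : ℤ)) : ℝ) * dz (fun z : Fin (d + 1) → ℤ => ((z a : ℤ) : ℝ)) l (x + (L : ℤ) • v)
        - (L : ℝ)⁻¹ * ((((x + (L : ℤ) • v) a % (L : ℤ) : ℤ)) : ℝ) * dz (fun z : Fin (d + 1) → ℤ => (((z b / (L : ℤ) : ℤ)) : ℝ)) l (x + (L : ℤ) • v)
      = ((L : ℝ) ^ 2)⁻¹ * ((((x + unitVec l) b % (L : ℤ) : ℤ)) : ℝ) * dz (fun z : Fin (d + 1) → ℤ => ((z a : ℤ) : ℝ)) l x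
        - (L : ℝ)⁻¹ * (((x a % (L : ℤ) : ℤ)) : ℝ) * dz (fun z : Fin (d + 1) → ℤ => (((z b / (L : ℤ) : ℤ)) : ℝ)) l x := by
  rw [edgePotential_apply hL hab, edgePotential_apply hL hab]
  have hc : ∀ c : Fin (d + 1), (x + (L : ℤ) • v) c % (L : ℤ) = x c % (L : ℤ) := fun c => by
    simp only [Pi.add_apply, Pi.smul_apply, smul_eq_mul]
    exact Int.add_mul_emod_self_left (x c) (L : ℤ) (v c)
  rw [hc a, hc b]

/-- [folklore] The curl of the residue-at-the-end form: `curv (β z ↦ t_b(z + e_β)·(dz x_a) β z) κ l x = −E_ab κ l·(1 − L·𝟙^{exit}_b(x))` (`a ≠ b`, `1 ≤ L`). -/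
theorem curv_residEnd_coord {L : ℕ} (hL : 1 ≤ L) {a b : Fin (d + 1)} (hab : a ≠ b) (κ l : Fin (d + 1)) (x : Fin (d + 1) → ℤ) :
    curv (fun β z => ((((z + unitVec β) b % (L : ℤ) : ℤ)) : ℝ) * dz (fun w : Fin (d + 1) → ℤ => ((w a : ℤ) : ℝ)) β z) κ l x
      = -(((if κ = a ∧ l = b then (1 : ℝ) else 0) - (if κ = b ∧ l = a then (1 : ℝ) else 0))
          * (1 - (L : ℝ) * (if x b % (L : ℤ) = (L : ℤ) - 1 then (1 : ℝ) else 0))) := by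
  rw [curv_smulEnd_fun_dz (fun z : Fin (d + 1) → ℤ => (((z b % (L : ℤ) : ℤ)) : ℝ)) (fun w : Fin (d + 1) → ℤ => ((w a : ℤ) : ℝ)) κ l x,
    dz_resid hL, dz_resid hL, dz_coordFn, dz_coordFn]
  by_cases hκa : κ = a
  · have hκb : κ ≠ b := fun h => hab (hκa.symm.trans h)
    have h2 : ¬ (κ = b ∧ l = a) := fun h => hκb h.1
    rw [if_pos hκa, if_neg hκb, if_neg h2]
    by_cases hlb : l = b
    · have hc : κ = a ∧ l = b := ⟨hκa, hlb⟩
      rw [if_pos hlb, if_pos hc, show x + unitVec κ = x + unitVec a from by rw [hκa], exit_add_unitVec_of_ne L b hab x]; ring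
    · rw [if_neg hlb, if_neg (show ¬ (κ = a ∧ l = b) from fun h => hlb h.2)]; ring
  · have h1 : ¬ (κ = a ∧ l = b) := fun h => hκa h.1
    rw [if_neg hκa, if_neg h1]
    by_cases hκb : κ = b
    · rw [if_pos hκb]
      by_cases hla : l = a
      · have hc : κ = b ∧ l = a := ⟨hκb, hla⟩
        rw [if_pos hla, if_pos hc, show x + unitVec l = x + unitVec a from by rw [hla], exit_add_unitVec_of_ne L b hab x]; ring
      · rw [if_neg hla, if_neg (show ¬ (κ = b ∧ l = a) from fun h => hla h.2)]; ring
    · rw [if_neg hκb, if_neg (show ¬ (κ = b ∧ l = a) from fun h => hκb h.1)]; ring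

/-- [folklore] The curl of the residue-times-face form: `curv (β z ↦ t_a(z)·(dzψ_b) β z) κ l x = E_ab κ l·(1 − L·𝟙^{exit}_a(x))·𝟙^{exit}_b(x)` (`a ≠ b`, `1 ≤ L`). -/
theorem curv_resid_blk {L : ℕ} (hL : 1 ≤ L) {a b : Fin (d + 1)} (hab : a ≠ b) (κ l : Fin (d + 1)) (x : Fin (d + 1) → ℤ) :
    curv (fun β z => (((z a % (L : ℤ) : ℤ)) : ℝ) * dz (fun w : Fin (d + 1) → ℤ => (((w b / (L : ℤ) : ℤ)) : ℝ)) β z) κ l x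
      = ((if κ = a ∧ l = b then (1 : ℝ) else 0) - (if κ = b ∧ l = a then (1 : ℝ) else 0))
          * (1 - (L : ℝ) * (if x a % (L : ℤ) = (L : ℤ) - 1 then (1 : ℝ) else 0)) * (if x b % (L : ℤ) = (L : ℤ) - 1 then (1 : ℝ) else 0) := by
  rw [curv_smul_fun_dz (fun z : Fin (d + 1) → ℤ => (((z a % (L : ℤ) : ℤ)) : ℝ)) (fun w : Fin (d + 1) → ℤ => (((w b / (L : ℤ) : ℤ)) : ℝ)) κ l x,
    dz_resid hL, dz_resid hL, dz_blk_eq_ite hL, dz_blk_eq_ite hL]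
  by_cases hκa : κ = a
  · have hκb : κ ≠ b := fun h => hab (hκa.symm.trans h)
    have h2 : ¬ (κ = b ∧ l = a) := fun h => hκb h.1
    rw [if_pos hκa, if_neg hκb, if_neg h2]
    by_cases hlb : l = b
    · have hc : κ = a ∧ l = b := ⟨hκa, hlb⟩
      rw [if_pos hlb, if_pos hc, show x + unitVec κ = x + unitVec a from by rw [hκa], exit_add_unitVec_of_ne L b hab x]; ring
    · rw [if_neg hlb, if_neg (show ¬ (κ = a ∧ l = b) from fun h => hlb h.2)]; ring
  · have h1 : ¬ (κ = a ∧ l = b) := fun h => hκa h.1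
    rw [if_neg hκa, if_neg h1]
    by_cases hla : l = a
    · rw [if_pos hla]
      by_cases hκb : κ = b
      · have hc : κ = b ∧ l = a := ⟨hκb, hla⟩
        rw [if_pos hκb, if_pos hc, show x + unitVec l = x + unitVec a from by rw [hla], exit_add_unitVec_of_ne L b hab x]; ring
      · rw [if_neg hκb, if_neg (show ¬ (κ = b ∧ l = a) from fun h => hκb h.1)]; ring
    · have h2 : ¬ (κ = b ∧ l = a) := fun h => hla h.2
      rw [if_neg hla, if_neg h2]
      by_cases hκb : κ = b
      · rw [if_pos hκb]; ring
      · rw [if_neg hκb]; ring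

/-- [folklore] `curv` is additive and homogeneous (pointwise). -/
theorem curv_sub_smul_apply (c c' : ℝ) (A B : Form1 (d + 1) ℝ) (κ l : Fin (d + 1)) (x : Fin (d + 1) → ℤ) :
    curv (fun β z => c * A β z - c' * B β z) κ l x = c * curv A κ l x - c' * curv B κ l x := by
  simp only [AffineAveraging.curv]; ring

/-- NOT IN PRINT; OUR BOOKKEEPING.  **THE CURL OF THE EDGE POTENTIAL**: `curv m̃_ab κ l x = E_ab κ l·(𝟙^{exit}_a(x)·𝟙^{exit}_b(x) − L⁻²)` (`a ≠ b`, `1 ≤ L`) — the edge-plaquette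
2-form minus the constant `L⁻²•E_ab`. -/
theorem curv_edgePotential {L : ℕ} (hL : 1 ≤ L) {a b : Fin (d + 1)} (hab : a ≠ b) (κ l : Fin (d + 1)) (x : Fin (d + 1) → ℤ) :
    curv (fun β z => ((L : ℝ) ^ 2)⁻¹ * ((((z + unitVec β) b % (L : ℤ) : ℤ)) : ℝ) * dz (fun w : Fin (d + 1) → ℤ => ((w a : ℤ) : ℝ)) β z
        - (L : ℝ)⁻¹ * (((z a % (L : ℤ) : ℤ)) : ℝ) * dz (fun w : Fin (d + 1) → ℤ => (((w b / (L : ℤ) : ℤ)) : ℝ)) β z) κ l x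
      = ((if κ = a ∧ l = b then (1 : ℝ) else 0) - (if κ = b ∧ l = a then (1 : ℝ) else 0))
          * ((if x a % (L : ℤ) = (L : ℤ) - 1 then (1 : ℝ) else 0) * (if x b % (L : ℤ) = (L : ℤ) - 1 then (1 : ℝ) else 0) - ((L : ℝ) ^ 2)⁻¹) := by
  have e : (fun β z => ((L : ℝ) ^ 2)⁻¹ * ((((z + unitVec β) b % (L : ℤ) : ℤ)) : ℝ) * dz (fun w : Fin (d + 1) → ℤ => ((w a : ℤ) : ℝ)) β z
        - (L : ℝ)⁻¹ * (((z a % (L : ℤ) : ℤ)) : ℝ) * dz (fun w : Fin (d + 1) → ℤ => (((w b / (L : ℤ) : ℤ)) : ℝ)) β z)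
      = fun β z => ((L : ℝ) ^ 2)⁻¹ * (((((z + unitVec β) b % (L : ℤ) : ℤ)) : ℝ) * dz (fun w : Fin (d + 1) → ℤ => ((w a : ℤ) : ℝ)) β z)
        - (L : ℝ)⁻¹ * ((((z a % (L : ℤ) : ℤ)) : ℝ) * dz (fun w : Fin (d + 1) → ℤ => (((w b / (L : ℤ) : ℤ)) : ℝ)) β z) := by
    funext β z; ring
  rw [e, curv_sub_smul_apply, curv_residEnd_coord hL hab, curv_resid_blk hL hab]
  have hL0 : (L : ℝ) ≠ 0 := by exact_mod_cast (show L ≠ 0 by omega)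
  field_simp
  ring

/-- NOT IN PRINT; OUR BOOKKEEPING.  **THE EDGE-PLAQUETTE 2-FORM** as the lattice wedge of the two coarse-coordinate derivatives:
`dzψ_a κ x·dzψ_b l (x + e_κ) − dzψ_a l x·dzψ_b κ (x + e_l) = E_ab κ l·𝟙^{exit}_a(x)·𝟙^{exit}_b(x)` (`a ≠ b`, `1 ≤ L`; `= ½·curv` of PART 7's face form by `curv_faceForm`). -/
theorem wedge_blk_eq {L : ℕ} (hL : 1 ≤ L) {a b : Fin (d + 1)} (hab : a ≠ b) (κ l : Fin (d + 1)) (x : Fin (d + 1) → ℤ) :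
    dz (fun w : Fin (d + 1) → ℤ => (((w a / (L : ℤ) : ℤ)) : ℝ)) κ x * dz (fun w : Fin (d + 1) → ℤ => (((w b / (L : ℤ) : ℤ)) : ℝ)) l (x + unitVec κ)
        - dz (fun w : Fin (d + 1) → ℤ => (((w a / (L : ℤ) : ℤ)) : ℝ)) l x * dz (fun w : Fin (d + 1) → ℤ => (((w b / (L : ℤ) : ℤ)) : ℝ)) κ (x + unitVec l)
      = ((if κ = a ∧ l = b then (1 : ℝ) else 0) - (if κ = b ∧ l = a then (1 : ℝ) else 0))
          * ((if x a % (L : ℤ) = (L : ℤ) - 1 then (1 : ℝ) else 0) * (if x b % (L : ℤ) = (L : ℤ) - 1 then (1 : ℝ) else 0)) := by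
  rw [dz_blk_eq_ite hL, dz_blk_eq_ite hL, dz_blk_eq_ite hL, dz_blk_eq_ite hL]
  by_cases hκa : κ = a
  · have hκb : κ ≠ b := fun h => hab (hκa.symm.trans h)
    have h2 : ¬ (κ = b ∧ l = a) := fun h => hκb h.1
    rw [if_pos hκa, if_neg hκb, if_neg h2]
    by_cases hlb : l = b
    · have hc : κ = a ∧ l = b := ⟨hκa, hlb⟩
      rw [if_pos hlb, if_pos hc, show x + unitVec κ = x + unitVec a from by rw [hκa], exit_add_unitVec_of_ne L b hab x]; ring
    · rw [if_neg hlb, if_neg (show ¬ (κ = a ∧ l = b) from fun h => hlb h.2)]; ring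
  · have h1 : ¬ (κ = a ∧ l = b) := fun h => hκa h.1
    rw [if_neg hκa, if_neg h1]
    by_cases hla : l = a
    · rw [if_pos hla]
      by_cases hκb : κ = b
      · have hc : κ = b ∧ l = a := ⟨hκb, hla⟩
        rw [if_pos hκb, if_pos hc, show x + unitVec l = x + unitVec a from by rw [hla], exit_add_unitVec_of_ne L b hab x]; ring
      · rw [if_neg hκb, if_neg (show ¬ (κ = b ∧ l = a) from fun h => hκb h.1)]; ring
    · have h2 : ¬ (κ = b ∧ l = a) := fun h => hla h.2
      rw [if_neg hla, if_neg h2]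
      by_cases hκb : κ = b
      · rw [if_pos hκb]; ring
      · rw [if_neg hκb]; ring

/-- [folklore] `curvAdj` is additive and homogeneous (pointwise). -/
theorem curvAdj_mul_sub_apply (G : Fin (d + 1) → Fin (d + 1) → (Fin (d + 1) → ℤ) → ℝ) (c : Fin (d + 1) → Fin (d + 1) → ℝ)
    (μ : Fin (d + 1)) (y : Fin (d + 1) → ℤ) :
    curvAdj (fun κ l x => G κ l x - c κ l) μ y = curvAdj G μ y := by
  have h0 := congrArg (fun F : Form1 (d + 1) ℝ => F μ y) (curvAdj_const (d := d + 1) (R := ℝ) c)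
  simp only [Pi.zero_apply] at h0
  simp only [AffineAveraging.curvAdj] at h0 ⊢
  simp only [Finset.sum_sub_distrib] at h0 ⊢
  linarith

/-- NOT IN PRINT; OUR BOOKKEEPING.  **THE CONSTANT PART IS INVISIBLE TO `curvAdj`**: `curvAdj (curv m̃_ab) = curvAdj (E_ab·𝟙^{exit}_a𝟙^{exit}_b)` — `(d*d) m̃_ab` is the co-derivative of the
edge-plaquette 2-form itself (`a ≠ b`, `1 ≤ L`). -/
theorem curvAdj_curv_edgePotential {L : ℕ} (hL : 1 ≤ L) {a b : Fin (d + 1)} (hab : a ≠ b) (μ : Fin (d + 1)) (y : Fin (d + 1) → ℤ) :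
    curvAdj (curv (fun β z => ((L : ℝ) ^ 2)⁻¹ * ((((z + unitVec β) b % (L : ℤ) : ℤ)) : ℝ) * dz (fun w : Fin (d + 1) → ℤ => ((w a : ℤ) : ℝ)) β z
        - (L : ℝ)⁻¹ * (((z a % (L : ℤ) : ℤ)) : ℝ) * dz (fun w : Fin (d + 1) → ℤ => (((w b / (L : ℤ) : ℤ)) : ℝ)) β z)) μ y
      = curvAdj (fun κ l x => ((if κ = a ∧ l = b then (1 : ℝ) else 0) - (if κ = b ∧ l = a then (1 : ℝ) else 0))
          * ((if x a % (L : ℤ) = (L : ℤ) - 1 then (1 : ℝ) else 0) * (if x b % (L : ℤ) = (L : ℤ) - 1 then (1 : ℝ) else 0))) μ y := by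
  have e : curv (fun β z => ((L : ℝ) ^ 2)⁻¹ * ((((z + unitVec β) b % (L : ℤ) : ℤ)) : ℝ) * dz (fun w : Fin (d + 1) → ℤ => ((w a : ℤ) : ℝ)) β z
        - (L : ℝ)⁻¹ * (((z a % (L : ℤ) : ℤ)) : ℝ) * dz (fun w : Fin (d + 1) → ℤ => (((w b / (L : ℤ) : ℤ)) : ℝ)) β z)
      = fun κ l x => ((if κ = a ∧ l = b then (1 : ℝ) else 0) - (if κ = b ∧ l = a then (1 : ℝ) else 0))
          * ((if x a % (L : ℤ) = (L : ℤ) - 1 then (1 : ℝ) else 0) * (if x b % (L : ℤ) = (L : ℤ) - 1 then (1 : ℝ) else 0))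
          - ((if κ = a ∧ l = b then (1 : ℝ) else 0) - (if κ = b ∧ l = a then (1 : ℝ) else 0)) * ((L : ℝ) ^ 2)⁻¹ := by
    funext κ l x; rw [curv_edgePotential hL hab]; ring
  rw [e]
  exact curvAdj_mul_sub_apply _ (fun κ l => ((if κ = a ∧ l = b then (1 : ℝ) else 0) - (if κ = b ∧ l = a then (1 : ℝ) else 0)) * ((L : ℝ) ^ 2)⁻¹) μ y

/-- [folklore] **THE POTENTIAL IS FREE UP TO AN EXACT FORM**: `curv (n − dz λ) = curv n` (`curv_dz`), pointwise. -/
theorem curv_sub_dz_apply (n : Form1 (d + 1) ℝ) (lam : Form0 (d + 1) ℝ) (κ l : Fin (d + 1)) (x : Fin (d + 1) → ℤ) :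
    curv (fun β z => n β z - dz lam β z) κ l x = curv n κ l x := by
  have h0 := congrArg (fun F : Form2 (d + 1) ℝ => F κ l x) (curv_dz (d := d + 1) (R := ℝ) lam)
  simp only [Pi.zero_apply] at h0
  simp only [AffineAveraging.curv] at h0 ⊢
  linarith

/-- [folklore] … hence `curvAdj (curv (n − dz λ)) = curvAdj (curv n)`: the `(d*d)`-image does not see the gauge representative (in particular a HARD-AXIAL one may be used). -/
theorem curvAdj_curv_sub_dz (n : Form1 (d + 1) ℝ) (lam : Form0 (d + 1) ℝ) :
    curvAdj (curv (fun β z => n β z - dz lam β z)) = curvAdj (curv n) := by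
  have e : curv (fun β z => n β z - dz lam β z) = curv n := by
    funext κ l x; exact curv_sub_dz_apply n lam κ l x
  rw [e]

/-! ## §3 The edge-plaquette curl total as a `(d*d)`-pairing -/
/-- [folklore] **THE TOTAL CURL OF AN ℓ¹ 1-FORM VANISHES**: `Σ'_x (curv r) a b x = 0` (four shifted copies of summable families). -/
theorem tsum_curv_eq_zero {r : Form1 (d + 1) ℝ} (hr : ∀ κ, Summable fun u => |r κ u|) (a b : Fin (d + 1)) :
    ∑' x, curv r a b x = 0 := by
  have hs : ∀ κ, Summable (r κ) := fun κ => (hr κ).of_abs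
  have hsh : ∀ (κ : Fin (d + 1)) (c : Fin (d + 1) → ℤ), Summable fun u => r κ (u + c) := fun κ c =>
    (Equiv.addRight c).summable_iff.2 (hs κ)
  have hshv : ∀ (κ : Fin (d + 1)) (c : Fin (d + 1) → ℤ), ∑' u, r κ (u + c) = ∑' u, r κ u := fun κ c =>
    (Equiv.addRight c).tsum_eq (r κ)
  simp only [AffineAveraging.curv]
  rw [show (fun x => r a x + r b (x + unitVec a) - r a (x + unitVec b) - r b x)
      = fun x => r a x - r a (x + unitVec b) + r b (x + unitVec a) - r b x from by funext x; ring]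
  rw [tsum_sub_add_sub (hs a) (hsh a _) (hsh b _) (hs b), hshv, hshv]; ring

/-- NOT IN PRINT; OUR BOOKKEEPING.  **THE EDGE-PLAQUETTE CURL TOTAL AS A `(d*d)`-PAIRING — GENERIC POTENTIAL** (`a ≠ b`; `r` with absolutely summable components): for ANY 1-form `n`
whose curl is the edge-plaquette 2-form up to a constant, `curv n κ l x = E_ab κ l·(𝟙^{exit}_a(x)𝟙^{exit}_b(x) − c)`,
`Σ'_x 𝟙^{exit}_a(x)·𝟙^{exit}_b(x)·(curv r) a b x = ½·Σ'_u Σ_κ r κ u·(curvAdj (curv n)) κ u` (PART 7's adjointness against the bounded `curv n`; the constant pairs with the total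
curl of `r`, which is `0`). -/
theorem edgeCurl_eq_half_tsum_mul_curvAdj_of_curv_eq {L : ℕ} {a b : Fin (d + 1)} (hab : a ≠ b) {r : Form1 (d + 1) ℝ}
    (hr : ∀ κ, Summable fun u => |r κ u|) {n : Form1 (d + 1) ℝ} {c : ℝ}
    (hn : ∀ κ l x, curv n κ l x = ((if κ = a ∧ l = b then (1 : ℝ) else 0) - (if κ = b ∧ l = a then (1 : ℝ) else 0))
          * ((if x a % (L : ℤ) = (L : ℤ) - 1 then (1 : ℝ) else 0) * (if x b % (L : ℤ) = (L : ℤ) - 1 then (1 : ℝ) else 0) - c)) :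
    ∑' x, (if x a % (L : ℤ) = (L : ℤ) - 1 then (1 : ℝ) else 0) * (if x b % (L : ℤ) = (L : ℤ) - 1 then (1 : ℝ) else 0) * curv r a b x
      = (1 / 2 : ℝ) * ∑' u, ∑ κ, r κ u * curvAdj (curv n) κ u := by
  have hB : ∀ κ l x, |curv n κ l x| ≤ 1 + |c| := by
    intro κ l x
    rw [hn]
    have h1 : |(if κ = a ∧ l = b then (1 : ℝ) else 0) - (if κ = b ∧ l = a then (1 : ℝ) else 0)| ≤ 1 := by
      split_ifs <;> norm_num
    have h2 : |(if x a % (L : ℤ) = (L : ℤ) - 1 then (1 : ℝ) else 0) * (if x b % (L : ℤ) = (L : ℤ) - 1 then (1 : ℝ) else 0) - c| ≤ 1 + |c| := by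
      refine (abs_sub _ _).trans (add_le_add ?_ le_rfl)
      split_ifs <;> norm_num
    rw [abs_mul]
    calc _ ≤ 1 * (1 + |c|) := mul_le_mul h1 h2 (abs_nonneg _) zero_le_one
      _ = 1 + |c| := one_mul _
  rw [tsum_mul_curvAdj_eq_tsum_curv_mul hr hB]
  have hpt : ∀ x, ∑ κ, ∑ l, curv r κ l x * curv n κ l x
      = 2 * ((if x a % (L : ℤ) = (L : ℤ) - 1 then (1 : ℝ) else 0) * (if x b % (L : ℤ) = (L : ℤ) - 1 then (1 : ℝ) else 0) * curv r a b x)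
        - 2 * (c * curv r a b x) := by
    intro x
    simp only [hn]
    rw [← Finset.sum_product' (f := fun κ l => curv r κ l x * (((if κ = a ∧ l = b then (1 : ℝ) else 0) - (if κ = b ∧ l = a then (1 : ℝ) else 0))
          * ((if x a % (L : ℤ) = (L : ℤ) - 1 then (1 : ℝ) else 0) * (if x b % (L : ℤ) = (L : ℤ) - 1 then (1 : ℝ) else 0) - c)))]
    have hne : ((a, b) : Fin (d + 1) × Fin (d + 1)) ≠ (b, a) := fun h => hab (Prod.mk.inj h).1
    rw [Finset.sum_eq_add (s := (Finset.univ : Finset (Fin (d + 1))) ×ˢ (Finset.univ : Finset (Fin (d + 1)))) (a, b) (b, a) hne ?_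
      (fun h => (h (by simp)).elim) (fun h => (h (by simp)).elim)]
    · have hanti : curv r b a x = -curv r a b x := by simp only [AffineAveraging.curv]; ring
      simp only [and_self, if_true]
      have h1 : ¬ (a = b ∧ b = a) := fun h => hab h.1
      rw [if_neg h1, if_neg (show ¬ (b = a ∧ a = b) from fun h => hab h.2), hanti]; ring
    · rintro ⟨κ, l⟩ - ⟨h1, h2⟩
      have h1' : ¬ (κ = a ∧ l = b) := fun h => h1 (by rw [h.1, h.2])
      have h2' : ¬ (κ = b ∧ l = a) := fun h => h2 (by rw [h.1, h.2])
      simp only [if_neg h1', if_neg h2', sub_self, zero_mul, mul_zero]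
  simp only [hpt]
  have hs : ∀ κ, Summable (r κ) := fun κ => (hr κ).of_abs
  have hsh : ∀ (κ : Fin (d + 1)) (e : Fin (d + 1) → ℤ), Summable fun u => r κ (u + e) := fun κ e =>
    (Equiv.addRight e).summable_iff.2 (hs κ)
  have hcurv : Summable fun x => curv r a b x := by
    have := (((hs a).add (hsh b (unitVec a))).sub (hsh a (unitVec b))).sub (hs b)
    refine this.congr (fun x => ?_)
    simp only [AffineAveraging.curv]
  have hind : Summable fun x => (if x a % (L : ℤ) = (L : ℤ) - 1 then (1 : ℝ) else 0) * (if x b % (L : ℤ) = (L : ℤ) - 1 then (1 : ℝ) else 0) * curv r a b x := by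
    refine Summable.of_norm_bounded hcurv.abs (fun x => ?_)
    rw [Real.norm_eq_abs, abs_mul, abs_mul]
    have h1 : |(if x a % (L : ℤ) = (L : ℤ) - 1 then (1 : ℝ) else 0)| ≤ 1 := by split_ifs <;> simp
    have h2 : |(if x b % (L : ℤ) = (L : ℤ) - 1 then (1 : ℝ) else 0)| ≤ 1 := by split_ifs <;> simp
    have := mul_le_mul h1 h2 (abs_nonneg _) zero_le_one
    nlinarith [abs_nonneg (curv r a b x), abs_nonneg ((if x a % (L : ℤ) = (L : ℤ) - 1 then (1 : ℝ) else 0)),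
      abs_nonneg ((if x b % (L : ℤ) = (L : ℤ) - 1 then (1 : ℝ) else 0))]
  rw [((hind.mul_left 2)).tsum_sub ((hcurv.mul_left c).mul_left 2), tsum_mul_left, tsum_mul_left, tsum_mul_left, tsum_curv_eq_zero hr a b]
  ring

/-- NOT IN PRINT; OUR BOOKKEEPING.  **THE EDGE-PLAQUETTE CURL TOTAL IS HALF THE `(d*d) m̃_ab`-PAIRING**: for `a ≠ b`, `1 ≤ L`, and `r` with absolutely summable components,
`Σ'_x 𝟙[x_a % L = L−1]·𝟙[x_b % L = L−1]·(curv r) a b x = ½·Σ'_u Σ_κ r κ u·(curvAdj (curv m̃_ab)) κ u` — the BOUNDED, `L`-PERIODIC potential. -/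
theorem edgeCurl_eq_half_tsum_mul_curvAdj_curv_edgePotential {L : ℕ} (hL : 1 ≤ L) {a b : Fin (d + 1)} (hab : a ≠ b) {r : Form1 (d + 1) ℝ}
    (hr : ∀ κ, Summable fun u => |r κ u|) :
    ∑' x, (if x a % (L : ℤ) = (L : ℤ) - 1 then (1 : ℝ) else 0) * (if x b % (L : ℤ) = (L : ℤ) - 1 then (1 : ℝ) else 0) * curv r a b x
      = (1 / 2 : ℝ) * ∑' u, ∑ κ, r κ u * curvAdj (curv (fun β z =>
          ((L : ℝ) ^ 2)⁻¹ * ((((z + unitVec β) b % (L : ℤ) : ℤ)) : ℝ) * dz (fun w : Fin (d + 1) → ℤ => ((w a : ℤ) : ℝ)) β z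
          - (L : ℝ)⁻¹ * (((z a % (L : ℤ) : ℤ)) : ℝ) * dz (fun w : Fin (d + 1) → ℤ => (((w b / (L : ℤ) : ℤ)) : ℝ)) β z)) κ u :=
  edgeCurl_eq_half_tsum_mul_curvAdj_of_curv_eq hab hr (c := ((L : ℝ) ^ 2)⁻¹) (fun κ l x => curv_edgePotential hL hab κ l x)

/-- NOT IN PRINT; OUR BOOKKEEPING.  **THE WILSON LETTER's EXIT⊗EXIT CHARGES RESUMMED AGAINST AN ℓ¹ SLOT FORM ARE `−½·⟨(d*d) m̃_ab, r⟩`** (`a ≠ b`, `1 ≤ L`; leaf-02 g55 PART 7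
`tsum_sum_mul_faceCharge_wilsonA_eq_neg_tsum_edgeCurl` composed with §3): so (W-γ) in the exit class, channel `(a,b)`, for a defect read-vector `r` reads `r ⊥ (d*d) m̃_ab` — with
`curvAdj ∘ curv` the field–field block of an2's bordered Hessian and `m̃_ab` bounded, periodic, and free up to `dz λ`.  The value of the pairing for road-P2's `v_γ + v_{α⁺}` is NOT
asserted. -/
theorem tsum_sum_mul_faceCharge_wilsonA_eq_neg_half_pairing {L : ℕ} (hL : 1 ≤ L) {a b : Fin (d + 1)} (hab : a ≠ b) {r : Form1 (d + 1) ℝ}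
    (hr : ∀ κ, Summable fun u => |r κ u|) :
    ∑' u, ∑ κ', r κ' u * (∑' z, (if z b % (L : ℤ) = (L : ℤ) - 1 then (1 : ℝ) else 0) *
        ∑' x, (if x a % (L : ℤ) = (L : ℤ) - 1 then (1 : ℝ) else 0) * StepJetData.wilsonA d κ' u x z (Sum.inl a) (Sum.inl b))
      = -((1 / 2 : ℝ) * ∑' u, ∑ κ, r κ u * curvAdj (curv (fun β z =>
          ((L : ℝ) ^ 2)⁻¹ * ((((z + unitVec β) b % (L : ℤ) : ℤ)) : ℝ) * dz (fun w : Fin (d + 1) → ℤ => ((w a : ℤ) : ℝ)) β z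
          - (L : ℝ)⁻¹ * (((z a % (L : ℤ) : ℤ)) : ℝ) * dz (fun w : Fin (d + 1) → ℤ => (((w b / (L : ℤ) : ℤ)) : ℝ)) β z)) κ u) := by
  rw [tsum_sum_mul_faceCharge_wilsonA_eq_neg_tsum_edgeCurl hL hab hr, edgeCurl_eq_half_tsum_mul_curvAdj_curv_edgePotential hL hab hr]

end Summit.QuantumFields.BalabanUV.Beta.GAN24.EdgePlaquettePotential

end
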